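import Summits.BirchSwinnertonDyer.BirchSwinnertonDyer.Theses.ResidualThetaTransportAtTwo
import Summits.BirchSwinnertonDyer.BirchSwinnertonDyer.Theorems.ResidualThetaTransportAtTwoRlfOfTwistedDescent
import Summits.BirchSwinnertonDyer.BirchSwinnertonDyer.Theorems.ResidualThetaTransportAtTwoRlfTwistedAmbientGeneric
import HarnessLib

/-!
# Item 23110 `ResidualLambdaFormulaNegDiscAtTwo` BY NAME from PRINT {weak Leopoldt at `2`, Prop. 4.12} + the twisted-lifting
# package (LIFT⁺₂ ∧ TCAS♯ for generic odd `u`) — the leaf door of road T (Greenberg's twist) at every Mordell–Weil rank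

Route `ResidualThetaTransportAtTwo` (RTT, crux r201, stmt-BirchSwinnertonDyer-23110) / `ThetaPartnerAtTwo` (TP2, aside r205).
Seat `prover-bsd-wall-tp2-p2x` g12 (`--supports stmt-BirchSwinnertonDyer-23110`). THEOREMS ONLY; LEAF file (imports the route file and
route-independent helpers only). Composes `SignedEC.TwistedSurj.rlf2_of_twistedDescent` (`…RlfOfTwistedDescent`, one curve, `c = 0`)
with the generic twist `SignedEC.TwistedSurj.exists_twistedCoinv_H1Sigma_of_print` (`…RlfTwistedAmbientGeneric`, PRINT Prop. 4.12 +
weak Leopoldt BY NAME — both conjuncts of the routes' PUB binder `PublishedInputsGreenbergControlAtTwo`).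

* `residualLambdaFormulaNegDiscAtTwo_of_print_of_twistedLift` — (hWL) → (h412) → «for every (κ, γ, S₀, E) of the branch: LIFT⁺₂(u) ∧
  TCAS♯(u) for all odd `u` outside a finite set» → **`Theses.ResidualThetaTransportAtTwo.ResidualLambdaFormulaNegDiscAtTwo`** BY NAME;
* `residualLambdaFormulaNegDiscAtTwo_TP2_of_print_of_twistedLift` — the same for the TP2 decl (identical text).

STATE OF 23110 AFTER ROAD T's ALGEBRA (this seat, gen 12): every rank ⟸ PRINT {WL@2, Prop. 4.12} (route binders) + the twisted-lifting
package = Greenberg's «variant of Cassels' theorem for `A_s`» (Prop. 4.13 + Remark, LNM 1716 pp. 122–123) at level `ℚ` for the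
finite twisted modules `E[2^J](χ_u)` with Kobayashi's `+` condition at `2` [Poitou–Tate over `ℚ` is a tree THEOREM; the twisted
Selmer structures exist in `Literature/…/ZpExtensionGaloisTwistSelmerStructure.lean` for the CLASSICAL condition at `p` — the `+`
variant, its dual-side control (δ2)⁺ and the local descents at `2` (T2)⁺ and at `S₀` (cd₂ ℤ₂ = 1) are the remaining, purely local,
research inputs]. HONEST FRAMING: CONDITIONAL; closes nothing; BSD is not proved by any of this.
References: [GreenbergLNM1716] §4 Props. 4.12–4.14 (pp. 119–124); [GreenbergVatsal2000] §2 Prop. (2.1), (10); [BDKim2013] Thm. 1.1.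
-/

set_option autoImplicit false
-- the Theorems namespace of this sub repeats the summit name by design (D-0017 nested layout)
set_option linter.dupNamespace false

noncomputable section

open scoped Classical NumberField AddSubgroup

open NumberField IsDedekindDomain

namespace Summit.BirchSwinnertonDyer.BirchSwinnertonDyer.Theorems.SignedEC.TwistedSurj

open Literature.NumberTheory.EllipticCurves Literature.NumberTheory.GaloisRepresentations
  WeierstrassCurve ZpExtension Literature.NumberTheory.EllipticCurves.Kobayashi2003
  Literature.NumberTheory.EllipticCurves.GreenbergVatsal2000 Literature.NumberTheory.EllipticCurves.GreenbergSelmer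
  Literature.NumberTheory.EllipticCurves.Rank1Residual

/-- **Item 23110 BY NAME from print + the twisted-lifting package.** Granted the routes' PUB binders weak Leopoldt
(`Greenberg1999.h1SigmaInfty_rank_eq_one`) and Prop. 4.12 (`Greenberg1999.prop412_noFiniteSubmodule_H1Sigma_of_rank_one`) BY NAME,
and — for every cyclotomic datum, every admissible `S₀` and every curve `E` of the branch — the twisted-lifting package
«(LIFT⁺₂)(u) ∧ (TCAS♯)(u) for all odd `u` outside a finite set» (Greenberg's Prop. 4.13 for `A_s` at level `ℚ` with Kobayashi's `+`
condition, plus the local `Γ`-descents; `u` generic), the route decl `ResidualLambdaFormulaNegDiscAtTwo` holds with `c = 0`: choose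
`u` outside the union of that finite set and the finite exceptional set of `exists_twistedCoinv_H1Sigma_of_print`, then
`rlf2_of_twistedDescent`. CONDITIONAL (two named facts + the displayed package); closes nothing.
[cite: GreenbergLNM1716, §4 Props. 4.12–4.14 (pp. 119–124)] [cite: GreenbergVatsal2000, §2 Prop. (2.1) and (10)] [cite: BDKim2013, Thm. 1.1] -/
theorem residualLambdaFormulaNegDiscAtTwo_of_print_of_twistedLift (hWL : Greenberg1999.h1SigmaInfty_rank_eq_one)
    (h412 : Greenberg1999.prop412_noFiniteSubmodule_H1Sigma_of_rank_one)
    (hTL : ∀ (κ : ZpExtension ℚ 2) (γ : Field.absoluteGaloisGroup ℚ), κ.IsCyclotomic → κ.IsTopGenerator γ →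
      ∀ (S₀ : Finset (HeightOneSpectrum (𝓞 ℚ))), (∀ v ∈ S₀, ((2 : ℕ) : 𝓞 ℚ) ∉ v.asIdeal) →
      ∀ (E : WeierstrassCurve ℚ) [E.IsElliptic] [E.IsGloballyMinimal], GoodSS E 2 → E.frobeniusTrace 2 = 0 → E.Δ < 0 →
        (∀ v : HeightOneSpectrum (𝓞 ℚ), ¬ E.HasGoodReductionAt v → v ∈ S₀) →
      ∃ B : Set ℤ, B.Finite ∧ ∀ u : ℤ, u ∉ B → (2 : ℤ) ∣ u - 1 →
        (∀ c ∈ unramifiedOutside κ.kerSubgroup ↥(E.geomPrimaryTorsion 2) 2 (↑S₀ : Set (HeightOneSpectrum (𝓞 ℚ))),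
      u • E.conjH1 2 κ.kerSubgroup γ c - c ∈
        ⨅ (v : HeightOneSpectrum (𝓞 ℚ)) (_ : ((2 : ℕ) : 𝓞 ℚ) ∈ v.asIdeal) (σ : Field.absoluteGaloisGroup ℚ),
          (localKummerOverOfEmb E 2 κ.kerSubgroup (closureEmb (K := ℚ) (v.adicCompletion ℚ))
            (⨆ n : ℕ, signedLocalPoints κ (v.adicCompletion ℚ) E 1 n)).comap (E.conjH1 2 κ.kerSubgroup σ) →
      ∃ c' ∈ unramifiedOutside κ.kerSubgroup ↥(E.geomPrimaryTorsion 2) 2 (↑S₀ : Set (HeightOneSpectrum (𝓞 ℚ))),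
        u • E.conjH1 2 κ.kerSubgroup γ c' = c' ∧ c - c' ∈
          ⨅ (v : HeightOneSpectrum (𝓞 ℚ)) (_ : ((2 : ℕ) : 𝓞 ℚ) ∈ v.asIdeal) (σ : Field.absoluteGaloisGroup ℚ),
            (localKummerOverOfEmb E 2 κ.kerSubgroup (closureEmb (K := ℚ) (v.adicCompletion ℚ))
              (⨆ n : ℕ, signedLocalPoints κ (v.adicCompletion ℚ) E 1 n)).comap (E.conjH1 2 κ.kerSubgroup σ)) ∧
        (∀ g : (∀ v : HeightOneSpectrum (𝓞 ℚ), Field.absoluteGaloisGroup (v.adicCompletion ℚ)),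
      (∀ v ∈ S₀, ∃ h ∈ κ.kerSubgroup, γ ^ 2 ^ padicValNat 2 ((Rat.HeightOneSpectrum.natGenerator v ^ 2 - 1) / 8) =
        h * resGal (K := ℚ) (v.adicCompletion ℚ) (g v)) →
      ∀ z : (∀ v : HeightOneSpectrum (𝓞 ℚ),
          discreteH1 (localSubgroup κ.kerSubgroup (v.adicCompletion ℚ)) (localPoints E (v.adicCompletion ℚ))),
        (∀ v ∈ S₀, ∃ k : ℕ, 2 ^ k • z v = 0) →
        (∀ v ∈ S₀, u ^ 2 ^ padicValNat 2 ((Rat.HeightOneSpectrum.natGenerator v ^ 2 - 1) / 8) •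
            Literature.NumberTheory.EllipticCurves.conjH1 (localSubgroup κ.kerSubgroup (v.adicCompletion ℚ))
              (localPoints E (v.adicCompletion ℚ)) (g v) (z v) = z v) →
        ∃ c ∈ unramifiedOutside κ.kerSubgroup ↥(E.geomPrimaryTorsion 2) 2 (↑S₀ : Set (HeightOneSpectrum (𝓞 ℚ))) ⊓
            ⨅ (v : HeightOneSpectrum (𝓞 ℚ)) (_ : ((2 : ℕ) : 𝓞 ℚ) ∈ v.asIdeal) (σ : Field.absoluteGaloisGroup ℚ),
              (localKummerOverOfEmb E 2 κ.kerSubgroup (closureEmb (K := ℚ) (v.adicCompletion ℚ))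
                (⨆ n : ℕ, signedLocalPoints κ (v.adicCompletion ℚ) E 1 n)).comap (E.conjH1 2 κ.kerSubgroup σ),
          u • E.conjH1 2 κ.kerSubgroup γ c = c ∧
            ∀ v ∈ S₀, E.localResOver 2 κ.kerSubgroup (v.adicCompletion ℚ) c = z v)) :
    Summit.BirchSwinnertonDyer.BirchSwinnertonDyer.Theses.ResidualThetaTransportAtTwo.ResidualLambdaFormulaNegDiscAtTwo := by
  intro κ γ hκ hγ S₀ hS2
  refine ⟨0, fun E _ _ hss ha hΔ hS D _ hX hμ ↦ ?_⟩
  obtain ⟨B, hB, hTLu⟩ := hTL κ γ hκ hγ S₀ hS2 E hss ha hΔ hS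
  have hgood : ∀ v : HeightOneSpectrum (𝓞 ℚ), v ∉ S₀ → ((2 : ℕ) : 𝓞 ℚ) ∉ v.asIdeal → E.HasGoodReductionAt v :=
    fun v hv _ ↦ by by_contra hng; exact hv (hS v hng)
  obtain ⟨u, huB, hu, hH⟩ := exists_twistedCoinv_H1Sigma_of_print hWL h412 E 2 κ γ hκ hγ S₀ hgood B hB
  obtain ⟨hlift, htwCas⟩ := hTLu u huB hu
  simpa only [Nat.add_zero] using
    rlf2_of_twistedDescent κ γ hκ hγ S₀ hS2 E hss ha hΔ hS D hX hμ hu hH hlift htwCas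

/-- **The same for the TP2 decl** `Theses.ThetaPartnerAtTwo.ResidualLambdaFormulaNegDiscAtTwo` (identical text).
[cite: GreenbergLNM1716, §4 Props. 4.12–4.14 (pp. 119–124)] [cite: GreenbergVatsal2000, §2 Prop. (2.1) and (10)] -/
theorem residualLambdaFormulaNegDiscAtTwo_TP2_of_print_of_twistedLift (hWL : Greenberg1999.h1SigmaInfty_rank_eq_one)
    (h412 : Greenberg1999.prop412_noFiniteSubmodule_H1Sigma_of_rank_one)
    (hTL : ∀ (κ : ZpExtension ℚ 2) (γ : Field.absoluteGaloisGroup ℚ), κ.IsCyclotomic → κ.IsTopGenerator γ →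
      ∀ (S₀ : Finset (HeightOneSpectrum (𝓞 ℚ))), (∀ v ∈ S₀, ((2 : ℕ) : 𝓞 ℚ) ∉ v.asIdeal) →
      ∀ (E : WeierstrassCurve ℚ) [E.IsElliptic] [E.IsGloballyMinimal], GoodSS E 2 → E.frobeniusTrace 2 = 0 → E.Δ < 0 →
        (∀ v : HeightOneSpectrum (𝓞 ℚ), ¬ E.HasGoodReductionAt v → v ∈ S₀) →
      ∃ B : Set ℤ, B.Finite ∧ ∀ u : ℤ, u ∉ B → (2 : ℤ) ∣ u - 1 →
        (∀ c ∈ unramifiedOutside κ.kerSubgroup ↥(E.geomPrimaryTorsion 2) 2 (↑S₀ : Set (HeightOneSpectrum (𝓞 ℚ))),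
      u • E.conjH1 2 κ.kerSubgroup γ c - c ∈
        ⨅ (v : HeightOneSpectrum (𝓞 ℚ)) (_ : ((2 : ℕ) : 𝓞 ℚ) ∈ v.asIdeal) (σ : Field.absoluteGaloisGroup ℚ),
          (localKummerOverOfEmb E 2 κ.kerSubgroup (closureEmb (K := ℚ) (v.adicCompletion ℚ))
            (⨆ n : ℕ, signedLocalPoints κ (v.adicCompletion ℚ) E 1 n)).comap (E.conjH1 2 κ.kerSubgroup σ) →
      ∃ c' ∈ unramifiedOutside κ.kerSubgroup ↥(E.geomPrimaryTorsion 2) 2 (↑S₀ : Set (HeightOneSpectrum (𝓞 ℚ))),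
        u • E.conjH1 2 κ.kerSubgroup γ c' = c' ∧ c - c' ∈
          ⨅ (v : HeightOneSpectrum (𝓞 ℚ)) (_ : ((2 : ℕ) : 𝓞 ℚ) ∈ v.asIdeal) (σ : Field.absoluteGaloisGroup ℚ),
            (localKummerOverOfEmb E 2 κ.kerSubgroup (closureEmb (K := ℚ) (v.adicCompletion ℚ))
              (⨆ n : ℕ, signedLocalPoints κ (v.adicCompletion ℚ) E 1 n)).comap (E.conjH1 2 κ.kerSubgroup σ)) ∧
        (∀ g : (∀ v : HeightOneSpectrum (𝓞 ℚ), Field.absoluteGaloisGroup (v.adicCompletion ℚ)),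
      (∀ v ∈ S₀, ∃ h ∈ κ.kerSubgroup, γ ^ 2 ^ padicValNat 2 ((Rat.HeightOneSpectrum.natGenerator v ^ 2 - 1) / 8) =
        h * resGal (K := ℚ) (v.adicCompletion ℚ) (g v)) →
      ∀ z : (∀ v : HeightOneSpectrum (𝓞 ℚ),
          discreteH1 (localSubgroup κ.kerSubgroup (v.adicCompletion ℚ)) (localPoints E (v.adicCompletion ℚ))),
        (∀ v ∈ S₀, ∃ k : ℕ, 2 ^ k • z v = 0) →
        (∀ v ∈ S₀, u ^ 2 ^ padicValNat 2 ((Rat.HeightOneSpectrum.natGenerator v ^ 2 - 1) / 8) •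
            Literature.NumberTheory.EllipticCurves.conjH1 (localSubgroup κ.kerSubgroup (v.adicCompletion ℚ))
              (localPoints E (v.adicCompletion ℚ)) (g v) (z v) = z v) →
        ∃ c ∈ unramifiedOutside κ.kerSubgroup ↥(E.geomPrimaryTorsion 2) 2 (↑S₀ : Set (HeightOneSpectrum (𝓞 ℚ))) ⊓
            ⨅ (v : HeightOneSpectrum (𝓞 ℚ)) (_ : ((2 : ℕ) : 𝓞 ℚ) ∈ v.asIdeal) (σ : Field.absoluteGaloisGroup ℚ),
              (localKummerOverOfEmb E 2 κ.kerSubgroup (closureEmb (K := ℚ) (v.adicCompletion ℚ))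
                (⨆ n : ℕ, signedLocalPoints κ (v.adicCompletion ℚ) E 1 n)).comap (E.conjH1 2 κ.kerSubgroup σ),
          u • E.conjH1 2 κ.kerSubgroup γ c = c ∧
            ∀ v ∈ S₀, E.localResOver 2 κ.kerSubgroup (v.adicCompletion ℚ) c = z v)) :
    Summit.BirchSwinnertonDyer.BirchSwinnertonDyer.Theses.ThetaPartnerAtTwo.ResidualLambdaFormulaNegDiscAtTwo :=
  residualLambdaFormulaNegDiscAtTwo_of_print_of_twistedLift hWL h412 hTL

end Summit.BirchSwinnertonDyer.BirchSwinnertonDyer.Theorems.SignedEC.TwistedSurj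

end
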